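import Summits.QuantumFields.YangMills.Theorems.BalabanUVNodesN12EUStepTokensAtRealisedDataLam
import Summits.QuantumFields.YangMills.Theorems.BalabanUVNodesK0Stub1BHolds
import Summits.QuantumFields.YangMills.Theorems.BalabanUVNodesN07Thm1Top7FromProp8GuardedB
import HarnessLib

/-!
# BalabanUVNodes ∕ N12 — [15] THEOREM 1 (E∕U) AT PRINT's [II] (2.3) DATUM, K0⁷'s GRID GUARD AND REGULAR-REALISED DATA ⟸ THE ONE-LENGTH STEP TOKEN ALONE
# (dag-n12-d's `thm1NamesB_grid_lamDatum_of_stepTokensB` with SUPPLYᴮ and LIFTᴮ DISCHARGED by dag-n12-c g38's `B11Thm1ExistsUniqueRealisedDataB{,Bridges}` ∕ `…N12EUStepTokensAtRealisedDataLam`)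
# ([Balaban1985Variational] Thm 1 (8) p.279, (11)–(14) pp.279–280, Prop. 2 p.281; [Balaban1984PropagatorsII] (2.3) p.224; [Balaban1988Convergent] (2.12) p.256, (2.18) p.257)

Cell `pub-ymgap` (HUMAN RULINGS D-0062 ∕ D-0149), lane `pub-ymgap-dag-n12-c` g38 (R134 seat (a), N12 = [B15], s1, lane owner).  `--kind proof --supports stmt-QuantumFields-27364 --as helper`
(K1⁹; count-neutral).  THEOREMS ONLY (0 `def`, 0 `instance`, 0 `sorry`); composition BY NAME.  v1.2: imports the V23 objects of record (`K0Stub1BHolds` + k0-s1-w1's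
`…N07Thm1Top7FromProp8GuardedB`) instead of dag-n12-d's `…NamesBInhabitedAtGridGuardLam` (V22 closure, residue after the seam) — the (R)ᴮ inhabitation re-derived privately; statements unchanged.

WHY.  N12's junction of record at print's datum (dag-n12-d g33 INTENT-168, v14ᴸᴮ) displays two [15]-Theorem-1 names as hypotheses: `h15` (regularity (8), INHABITED at `Adm := A‴` modulo
K0⁷'s stub by the S1c road) and `h15EU` ((E∕U); NO producer — orphan edge N07 → N12).  dag-n12-d's `…Thm1NamesBInhabitedAtGridGuardLam` (✓) shows: at print's datum and K0⁷'s grid guard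
`A‴(c,c₀,c₁)` the (R)ᴮ name is INHABITED hypothesis-free (§1 there), and the (E∕U)ᴮ name follows from THREE tokens ᴮ — STEPᴮ, SUPPLYᴮ (length 1), LIFTᴮ — none of which had a producer at
any datum (§2 there).  This seat's s1 walk of [15] p. 279 (11) located that SUPPLY-at-1 ∕ LIFT are NOT bookkeeping for a general (7)-datum (print's example filling leaves the interface
plaquettes uncontrolled) but ARE identities at REGULAR-REALISED data (`B11Thm1ExistsUniqueRealisedDataB.dataRegularRealisedTopOf F N`: realised below the top + full per-level plaquette
smallness + the fine member small on the plaquettes meeting `Ω₁`) — the class of the junction's own datum `M˙(Q_k^{s*}Ṽ_k)` (`B11Thm1ExistsUniqueRealisedDataQsstar`).  THIS FILE composes: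
at `(A‴, lamDatum F, dataRegularRealisedTopOf F 2)` the (R)ᴮ name is inhabited (antitone in the data predicate) AND the (E∕U)ᴮ name follows from the ONE-LENGTH STEP token ALONE —
N12's [15] input shrinks to exactly [15] Prop. 2 + Sects. B–E at one length (N07's), for every `C₁ ≥ 2L³`.

WHAT THIS FILE PROVES (`N = 2`, every `F : T4Family`).
* §1 ★★★★ `thm1EUNameB_grid_lamDatum_realised_of_step (F)`: `∃ (c c₀ c₁) (B₃ a₀ a₁), 2L² ≤ B₃ ∧ 0 < a₀ ∧ 0 < a₁ ∧ (R)ᴮ[A‴, lamDatum F, dataRegularRealisedTopOf F 2] ∧ ∀ C₁, 2L³ ≤ C₁ →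
  STEPᴮ[A‴, lamDatum F, dataRegularRealisedTopOf F 2, C₁] → (E∕U)ᴮ[A‴, lamDatum F, dataRegularRealisedTopOf F 2]` (n12-d §1 ∘ `.of_imp_dat` ∘ this seat's
  `variationalThm1EUSepCoP7MGB_realised_of_step_of_reg`; `8L³ < C₁B₃` from `2L³ ≤ C₁`, `2L² ≤ B₃`, `L ≥ 3`).
* §3 (v1.1, APPEND-ONLY) ★★★★ `thm1NamesB_grid_lamDatum_lamTop_and_realised_of_step (F)`: ONE set of stub constants with (R)ᴮ at `dataSmall7LamTopOf F 2` (unchanged) AND at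
  `dataRegularRealisedTopOf F 2`, and STEPᴮ[`dataSmall7LamTopOf`] → (E∕U)ᴮ[`dataRegularRealisedTopOf`] — what a junction re-keying ONLY its (E∕U) letter consumes.
* §2 ★★★ `thm1EUNameB_grid_lamDatum_realised_of_step_lamTop (F)` ∕ `…_pTop (F)`: the same with the step token read at the landed data predicates `dataSmall7LamTopOf F 2` (print's (α)
  reading — the currency K0's V23 stub 1 is filed in) ∕ `dataSmall7PTopOf F 2` (the (b) reading — v14ᴸᴮ's currency): WEAKER data hypotheses, so either serves.

HONEST FRAMING.  By-name composition of LANDED theorems; CONDITIONAL on the ONE-LENGTH STEP token ([15] Prop. 2 + Sects. B–E given `U₀` with (14)) — no producer in the tree (N07); the (R)ᴮ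
conjunct is unconditional (its content is dag-n07-e's closed V23 stub-1 text + k0-s1-w1's 53′ bridge).  WHAT THIS IS NOT: not a discharge of `h15EU` AS DISPLAYED by v14ᴸᴮ — that hypothesis
is the (E∕U)ᴮ name over `dataSmall7PTopOf F 2` (all (7)-data), which this file does NOT produce (for general data the SUPPLY ∕ LIFT inputs are a genuine extension lemma, LOCATED); a junction
edition keyed on `dataRegularRealisedTopOf F 2` (its datum row by `B11Thm1ExistsUniqueRealisedDataQsstar.dataRegularRealisedTop_avgFamily_qsstarGIter0_maxDomT`) would display exactly the
name produced here — dag-n12-d's pen.  K0⁷ NOT closed; K1⁹ OPEN; N12 NOT discharged; counts unmoved (typed 28∕28 · discharged 8∕28, 8∕27 excl. NODE O); one finite 𝕋⁴ programme at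
fixed `ε = L^{-K}` — R4 closes only the conditional rung `BalabanLadder.UV`; nothing continuum ∕ ℝ⁴ ∕ OS; the Yang–Mills mass gap (Clay) is NOT proved by any of this.
-/

noncomputable section

namespace Summit.QuantumFields.YangMills.BalabanUVNodes.N12Thm1EUNameBOfStepAtRealisedDataLam

open Literature.MathematicalPhysics.QuantumFieldTheory.Balaban1983to89
open Literature.MathematicalPhysics.QuantumFieldTheory.Balaban1983to89.Node00
open Literature.MathematicalPhysics.QuantumFieldTheory.Balaban1983to89.T4Continuum
open B11Thm1ExistsUniqueInductionG (truncSeq)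
open B11Thm1ExistsUniqueTokensGB (VariationalThm1EUSepCoP7MGB VariationalThm1EUStepCoP7MGB)
open B11Thm1ExistsUniqueRealisedDataB (dataRegularRealisedTopOf dataSmall7PTopOf_of_dataRegularRealisedTopOf dataSmall7LamTopOf_of_dataRegularRealisedTopOf)
open Summit.QuantumFields.YangMills.BalabanUVNodes.N12EUStepTokensAtRealisedDataLam (variationalThm1EUSepCoP7MGB_realised_of_step_of_reg)
open Summit.QuantumFields.YangMills.BalabanUVNodes.N07Thm1Top7FromProp8GuardedB (variationalThm1RegSepCoP7MGB_of_prop8TopStepGB_lamDatum)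
open Summit.QuantumFields.YangMills.BalabanUVNodes.K0Stub1BHolds (prop8StepCoPGridGBAt_holds)

variable (F : T4Family)

/-- K0⁷'s grid guard `A‴(c,c₀,c₁)` implies the standing range `k ≤ m + K` (`(F.P K).m = F.m`). [cite: Balaban1985Variational, Thm 1 p.279 (bookkeeping); Balaban1987RG1, (0.1) p.251] -/
private theorem gridGuard_le (c c₀ c₁ : ℕ) (ν : Stage7Numerics) (M : ℕ) (g : ℕ → ℝ) (K k : ℕ) (s : SeqOfRecord F ν M g K k)
    (h : c ≤ ν.M₁ ∧ k + c₀ ≤ F.m + K ∧ F.L ^ c₁ ∣ M ∧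
      ∀ i, 1 ≤ i → i ≤ k → dCubeSide (F.P K).L M (RkOfRecord (F.P K).L ν.r (g i)) i ∣ (F.P K).sitesPerDir 0) :
    k ≤ (F.P K).m + (F.P K).K := by
  have _ := s
  have h2 := h.2.1
  show k ≤ F.m + K
  omega

/-- K0⁷'s grid guard is stable under print's truncation (dag-n12-d's `gridGuard_of_succ`, restated with the sequence binders of the induction's `hAdmTr` row).
[cite: Balaban1985Variational, (11) p.279 (bookkeeping); Balaban1988Convergent, (2.18) p.257] -/
private theorem gridGuard_truncSeq (c c₀ c₁ : ℕ) (ν : Stage7Numerics) (M : ℕ) (g : ℕ → ℝ) (K k : ℕ) (s : SeqOfRecord F ν M g K (k + 1)) (_hk : 0 < k)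
    (h : c ≤ ν.M₁ ∧ k + 1 + c₀ ≤ F.m + K ∧ F.L ^ c₁ ∣ M ∧
      ∀ i, 1 ≤ i → i ≤ k + 1 → dCubeSide (F.P K).L M (RkOfRecord (F.P K).L ν.r (g i)) i ∣ (F.P K).sitesPerDir 0) :
    c ≤ ν.M₁ ∧ k + c₀ ≤ F.m + K ∧ F.L ^ c₁ ∣ M ∧
      ∀ i, 1 ≤ i → i ≤ k → dCubeSide (F.P K).L M (RkOfRecord (F.P K).L ν.r (g i)) i ∣ (F.P K).sitesPerDir 0 :=
  have _ := truncSeq s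
  ⟨h.1, by have := h.2.1; omega, h.2.2.1, fun i h1 hi => h.2.2.2 i h1 (Nat.le_succ_of_le hi)⟩

/-- (v1.2) PRIVATE RE-DERIVATION of dag-n12-d's `N12Thm1NamesBInhabitedAtGridGuardLam.thm1RegNameB_grid_lamDatum_inhabited` (statement verbatim, proof = its three lines: K0⁷'s CLOSED stub-1
text `K0Stub1BHolds.prop8StepCoPGridGBAt_holds` through k0-s1-w1's 53′ bridge `variationalThm1RegSepCoP7MGB_of_prop8TopStepGB_lamDatum`) — so that this file imports the V23 objects of record
(`K0Stub1BHolds`) and NOT the V22-closure module `…NamesBInhabitedAtGridGuardLam` (residue after the seam re-feed). [cite: Balaban1985Variational, Thm 1 (8) p.279, Prop. 8 p.304; Balaban1984PropagatorsII, (2.3) p.224; Balaban1988Convergent, (2.12) p.256, (2.18) p.257] -/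
private theorem thm1RegNameB_grid_lamDatum_inhabited :
    ∃ (c c₀ c₁ : ℕ) (B₃ a₀ a₁ : ℝ), 2 * (F.L : ℝ) ^ 2 ≤ B₃ ∧ 0 < a₀ ∧ 0 < a₁ ∧
      VariationalThm1RegSepCoP7MGB F 2
        (fun ν M g K k _s => c ≤ ν.M₁ ∧ k + c₀ ≤ F.m + K ∧ F.L ^ c₁ ∣ M ∧
          ∀ i, 1 ≤ i → i ≤ k → dCubeSide (F.P K).L M (RkOfRecord (F.P K).L ν.r (g i)) i ∣ (F.P K).sitesPerDir 0) (lamDatum F) (dataSmall7LamTopOf F 2) B₃ a₀ a₁ := by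
  obtain ⟨c, c₀, c₁, B₃, a₀, a₁, hB₃, ha₀, ha₁, h8⟩ := prop8StepCoPGridGBAt_holds F
  have hL : (0 : ℝ) < F.L := by exact_mod_cast (show 0 < F.L by have := F.hL.2; omega)
  have hB : 0 < B₃ := lt_of_lt_of_le (by positivity) hB₃
  exact ⟨c, c₀, c₁, B₃, a₀, a₁, hB₃, ha₀, ha₁, variationalThm1RegSepCoP7MGB_of_prop8TopStepGB_lamDatum hB h8⟩

/-! ## §1  (R)ᴮ inhabited and (E∕U)ᴮ ⟸ STEPᴮ at `(A‴, lamDatum F, dataRegularRealisedTopOf F 2)` -/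

/-- ★★★★ **[15] THEOREM 1 AT PRINT's [II] (2.3) DATUM, K0⁷'s GRID GUARD, REGULAR-REALISED DATA: (R)ᴮ INHABITED AND (E∕U)ᴮ ⟸ THE ONE-LENGTH STEP TOKEN ALONE** (`N = 2`, every
`F : T4Family`): there are stub constants `(c, c₀, c₁, B₃, a₀, a₁)` with `2L² ≤ B₃`, `0 < a₀`, `0 < a₁` such that the (R)ᴮ-name `Node00.VariationalThm1RegSepCoP7MGB F 2 A‴ (lamDatum F)
(dataRegularRealisedTopOf F 2) B₃ a₀ a₁` HOLDS (dag-n12-d's hypothesis-free inhabitation at `dataSmall7LamTopOf`, antitone in the data predicate), and for every `C₁ ≥ 2L³` the ONE-LENGTH STEP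
token `VariationalThm1EUStepCoP7MGB F 2 A‴ (lamDatum F) (dataRegularRealisedTopOf F 2) C₁ B₃ a₀ a₁` ([15] Prop. 2 + Sects. B–E given `U₀` with (14)) IMPLIES the (E∕U)ᴮ-name
`VariationalThm1EUSepCoP7MGB F 2 A‴ (lamDatum F) (dataRegularRealisedTopOf F 2) B₃ a₀ a₁` — print's induction with SUPPLY-at-1 and LIFT proved at regular-realised data.
[cite: Balaban1985Variational, Thm 1 (8) p.279, (11) p.279, (12)–(14) p.280, Prop. 2 p.281, Prop. 8 p.304; Balaban1984PropagatorsII, (2.3) p.224; Balaban1988Convergent, (2.12) p.256, (2.18) p.257] -/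
theorem thm1EUNameB_grid_lamDatum_realised_of_step :
    ∃ (c c₀ c₁ : ℕ) (B₃ a₀ a₁ : ℝ), 2 * (F.L : ℝ) ^ 2 ≤ B₃ ∧ 0 < a₀ ∧ 0 < a₁ ∧
      VariationalThm1RegSepCoP7MGB F 2
        (fun ν M g K k _s => c ≤ ν.M₁ ∧ k + c₀ ≤ F.m + K ∧ F.L ^ c₁ ∣ M ∧
          ∀ i, 1 ≤ i → i ≤ k → dCubeSide (F.P K).L M (RkOfRecord (F.P K).L ν.r (g i)) i ∣ (F.P K).sitesPerDir 0) (lamDatum F) (dataRegularRealisedTopOf F 2) B₃ a₀ a₁ ∧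
      ∀ C₁ : ℝ, 2 * (F.L : ℝ) ^ 3 ≤ C₁ →
        VariationalThm1EUStepCoP7MGB F 2
          (fun ν M g K k _s => c ≤ ν.M₁ ∧ k + c₀ ≤ F.m + K ∧ F.L ^ c₁ ∣ M ∧
            ∀ i, 1 ≤ i → i ≤ k → dCubeSide (F.P K).L M (RkOfRecord (F.P K).L ν.r (g i)) i ∣ (F.P K).sitesPerDir 0) (lamDatum F) (dataRegularRealisedTopOf F 2) C₁ B₃ a₀ a₁ →
        VariationalThm1EUSepCoP7MGB F 2
          (fun ν M g K k _s => c ≤ ν.M₁ ∧ k + c₀ ≤ F.m + K ∧ F.L ^ c₁ ∣ M ∧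
            ∀ i, 1 ≤ i → i ≤ k → dCubeSide (F.P K).L M (RkOfRecord (F.P K).L ν.r (g i)) i ∣ (F.P K).sitesPerDir 0) (lamDatum F) (dataRegularRealisedTopOf F 2) B₃ a₀ a₁ := by
  obtain ⟨c, c₀, c₁, B₃, a₀, a₁, hB₃, ha₀, ha₁, hR⟩ := thm1RegNameB_grid_lamDatum_inhabited (F := F)
  have hR' := hR.of_imp_dat (dataSmall7LamTopOf_of_dataRegularRealisedTopOf (F := F) (N := 2))
  have hL3 : (3 : ℝ) ≤ F.L := by exact_mod_cast (show 3 ≤ F.L by have := F.hL11; omega)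
  have hB₃0 : 0 ≤ B₃ := le_trans (by positivity) hB₃
  refine ⟨c, c₀, c₁, B₃, a₀, a₁, hB₃, ha₀, ha₁, hR', fun C₁ hC₁ hstep => ?_⟩
  have hCB : 8 * (F.L : ℝ) ^ 3 < C₁ * B₃ := by
    have hL0 : (0 : ℝ) < (F.L : ℝ) ^ 3 := by positivity
    have hL2 : (9 : ℝ) ≤ (F.L : ℝ) ^ 2 := by nlinarith
    have h1 : 2 * (F.L : ℝ) ^ 3 * (2 * (F.L : ℝ) ^ 2) ≤ C₁ * B₃ := mul_le_mul hC₁ hB₃ (by positivity) (le_trans (by positivity) hC₁)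
    have h2 : 8 * (F.L : ℝ) ^ 3 < 2 * (F.L : ℝ) ^ 3 * (2 * (F.L : ℝ) ^ 2) := by nlinarith
    exact h2.trans_le h1
  exact variationalThm1EUSepCoP7MGB_realised_of_step_of_reg _ (fun ν M g K k s h => gridGuard_le F c c₀ c₁ ν M g K k s h)
    (fun ν M g K k s hk h => gridGuard_truncSeq F c c₀ c₁ ν M g K k s hk h) hB₃0 hC₁ hCB hstep hR'

/-! ## §2  The same with the step token read at the landed data predicates -/

/-- ★★★ **(E∕U)ᴮ AT REGULAR-REALISED DATA ⟸ THE STEP TOKEN AT PRINT's (α) DATA PREDICATE `dataSmall7LamTopOf F 2`** (the currency K0's V23 stub 1 is filed in; weaker data hypothesis ⇒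
it serves regular-realised data by `.of_imp_dat`). [cite: Balaban1985Variational, Thm 1 p.279, (7) p.278, Prop. 2 p.281; Balaban1984PropagatorsII, (2.3) p.224; Balaban1988Convergent, (2.18) p.257] -/
theorem thm1EUNameB_grid_lamDatum_realised_of_step_lamTop :
    ∃ (c c₀ c₁ : ℕ) (B₃ a₀ a₁ : ℝ), 2 * (F.L : ℝ) ^ 2 ≤ B₃ ∧ 0 < a₀ ∧ 0 < a₁ ∧
      VariationalThm1RegSepCoP7MGB F 2
        (fun ν M g K k _s => c ≤ ν.M₁ ∧ k + c₀ ≤ F.m + K ∧ F.L ^ c₁ ∣ M ∧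
          ∀ i, 1 ≤ i → i ≤ k → dCubeSide (F.P K).L M (RkOfRecord (F.P K).L ν.r (g i)) i ∣ (F.P K).sitesPerDir 0) (lamDatum F) (dataRegularRealisedTopOf F 2) B₃ a₀ a₁ ∧
      ∀ C₁ : ℝ, 2 * (F.L : ℝ) ^ 3 ≤ C₁ →
        VariationalThm1EUStepCoP7MGB F 2
          (fun ν M g K k _s => c ≤ ν.M₁ ∧ k + c₀ ≤ F.m + K ∧ F.L ^ c₁ ∣ M ∧
            ∀ i, 1 ≤ i → i ≤ k → dCubeSide (F.P K).L M (RkOfRecord (F.P K).L ν.r (g i)) i ∣ (F.P K).sitesPerDir 0) (lamDatum F) (dataSmall7LamTopOf F 2) C₁ B₃ a₀ a₁ →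
        VariationalThm1EUSepCoP7MGB F 2
          (fun ν M g K k _s => c ≤ ν.M₁ ∧ k + c₀ ≤ F.m + K ∧ F.L ^ c₁ ∣ M ∧
            ∀ i, 1 ≤ i → i ≤ k → dCubeSide (F.P K).L M (RkOfRecord (F.P K).L ν.r (g i)) i ∣ (F.P K).sitesPerDir 0) (lamDatum F) (dataRegularRealisedTopOf F 2) B₃ a₀ a₁ := by
  obtain ⟨c, c₀, c₁, B₃, a₀, a₁, hB₃, ha₀, ha₁, hR, h⟩ := thm1EUNameB_grid_lamDatum_realised_of_step F
  exact ⟨c, c₀, c₁, B₃, a₀, a₁, hB₃, ha₀, ha₁, hR, fun C₁ hC₁ hstep =>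
    h C₁ hC₁ (hstep.of_imp_dat (dataSmall7LamTopOf_of_dataRegularRealisedTopOf (F := F) (N := 2)))⟩

/-- ★★★ **(E∕U)ᴮ AT REGULAR-REALISED DATA ⟸ THE STEP TOKEN AT THE RECORD's (b) DATA PREDICATE `dataSmall7PTopOf F 2`** (v14ᴸᴮ's currency for its two [15] names).
[cite: Balaban1985Variational, Thm 1 p.279, (7) p.278, Prop. 2 p.281; Balaban1988Convergent, (2.10)–(2.12) p.256, (2.18) p.257] -/
theorem thm1EUNameB_grid_lamDatum_realised_of_step_pTop :
    ∃ (c c₀ c₁ : ℕ) (B₃ a₀ a₁ : ℝ), 2 * (F.L : ℝ) ^ 2 ≤ B₃ ∧ 0 < a₀ ∧ 0 < a₁ ∧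
      VariationalThm1RegSepCoP7MGB F 2
        (fun ν M g K k _s => c ≤ ν.M₁ ∧ k + c₀ ≤ F.m + K ∧ F.L ^ c₁ ∣ M ∧
          ∀ i, 1 ≤ i → i ≤ k → dCubeSide (F.P K).L M (RkOfRecord (F.P K).L ν.r (g i)) i ∣ (F.P K).sitesPerDir 0) (lamDatum F) (dataRegularRealisedTopOf F 2) B₃ a₀ a₁ ∧
      ∀ C₁ : ℝ, 2 * (F.L : ℝ) ^ 3 ≤ C₁ →
        VariationalThm1EUStepCoP7MGB F 2
          (fun ν M g K k _s => c ≤ ν.M₁ ∧ k + c₀ ≤ F.m + K ∧ F.L ^ c₁ ∣ M ∧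
            ∀ i, 1 ≤ i → i ≤ k → dCubeSide (F.P K).L M (RkOfRecord (F.P K).L ν.r (g i)) i ∣ (F.P K).sitesPerDir 0) (lamDatum F) (dataSmall7PTopOf F 2) C₁ B₃ a₀ a₁ →
        VariationalThm1EUSepCoP7MGB F 2
          (fun ν M g K k _s => c ≤ ν.M₁ ∧ k + c₀ ≤ F.m + K ∧ F.L ^ c₁ ∣ M ∧
            ∀ i, 1 ≤ i → i ≤ k → dCubeSide (F.P K).L M (RkOfRecord (F.P K).L ν.r (g i)) i ∣ (F.P K).sitesPerDir 0) (lamDatum F) (dataRegularRealisedTopOf F 2) B₃ a₀ a₁ := by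
  obtain ⟨c, c₀, c₁, B₃, a₀, a₁, hB₃, ha₀, ha₁, hR, h⟩ := thm1EUNameB_grid_lamDatum_realised_of_step F
  exact ⟨c, c₀, c₁, B₃, a₀, a₁, hB₃, ha₀, ha₁, hR, fun C₁ hC₁ hstep =>
    h C₁ hC₁ (hstep.of_imp_dat (dataSmall7PTopOf_of_dataRegularRealisedTopOf (F := F) (N := 2)))⟩

/-! ## §3  (v1.1, append-only) The same constants serve the (R)ᴮ name at BOTH data predicates — for a junction that keeps its (8)-letter at the landed reading -/

/-- ★★★★ **v1.1 — ONE SET OF STUB CONSTANTS FOR BOTH NAMES: (R)ᴮ at print's (α) predicate `dataSmall7LamTopOf F 2` (dag-n12-d's inhabitation, UNCHANGED) AND at regular-realised data,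
AND (E∕U)ᴮ at regular-realised data ⟸ the ONE-LENGTH STEP token at `dataSmall7LamTopOf F 2`** — so that a junction edition keeps its (8)-letter in the landed currency (K0⁷ stub 1; the class
kit and the (T1@q₀) rows read it there) and re-keys ONLY the (E∕U) letter on `dataRegularRealisedTopOf F 2` (`B15Prop1Thm1RowsOfExistsUniqueAtLengthBR`), all at the SAME `(c, c₀, c₁, B₃, a₀, a₁)`.
[cite: Balaban1985Variational, Thm 1 (8) p.279, (11)–(14) pp.279–280, Prop. 2 p.281, Prop. 8 p.304; Balaban1984PropagatorsII, (2.3) p.224; Balaban1988Convergent, (2.12) p.256, (2.18) p.257] -/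
theorem thm1NamesB_grid_lamDatum_lamTop_and_realised_of_step :
    ∃ (c c₀ c₁ : ℕ) (B₃ a₀ a₁ : ℝ), 2 * (F.L : ℝ) ^ 2 ≤ B₃ ∧ 0 < a₀ ∧ 0 < a₁ ∧
      VariationalThm1RegSepCoP7MGB F 2
        (fun ν M g K k _s => c ≤ ν.M₁ ∧ k + c₀ ≤ F.m + K ∧ F.L ^ c₁ ∣ M ∧
          ∀ i, 1 ≤ i → i ≤ k → dCubeSide (F.P K).L M (RkOfRecord (F.P K).L ν.r (g i)) i ∣ (F.P K).sitesPerDir 0) (lamDatum F) (dataSmall7LamTopOf F 2) B₃ a₀ a₁ ∧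
      VariationalThm1RegSepCoP7MGB F 2
        (fun ν M g K k _s => c ≤ ν.M₁ ∧ k + c₀ ≤ F.m + K ∧ F.L ^ c₁ ∣ M ∧
          ∀ i, 1 ≤ i → i ≤ k → dCubeSide (F.P K).L M (RkOfRecord (F.P K).L ν.r (g i)) i ∣ (F.P K).sitesPerDir 0) (lamDatum F) (dataRegularRealisedTopOf F 2) B₃ a₀ a₁ ∧
      ∀ C₁ : ℝ, 2 * (F.L : ℝ) ^ 3 ≤ C₁ →
        VariationalThm1EUStepCoP7MGB F 2
          (fun ν M g K k _s => c ≤ ν.M₁ ∧ k + c₀ ≤ F.m + K ∧ F.L ^ c₁ ∣ M ∧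
            ∀ i, 1 ≤ i → i ≤ k → dCubeSide (F.P K).L M (RkOfRecord (F.P K).L ν.r (g i)) i ∣ (F.P K).sitesPerDir 0) (lamDatum F) (dataSmall7LamTopOf F 2) C₁ B₃ a₀ a₁ →
        VariationalThm1EUSepCoP7MGB F 2
          (fun ν M g K k _s => c ≤ ν.M₁ ∧ k + c₀ ≤ F.m + K ∧ F.L ^ c₁ ∣ M ∧
            ∀ i, 1 ≤ i → i ≤ k → dCubeSide (F.P K).L M (RkOfRecord (F.P K).L ν.r (g i)) i ∣ (F.P K).sitesPerDir 0) (lamDatum F) (dataRegularRealisedTopOf F 2) B₃ a₀ a₁ := by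
  obtain ⟨c, c₀, c₁, B₃, a₀, a₁, hB₃, ha₀, ha₁, hR⟩ := thm1RegNameB_grid_lamDatum_inhabited (F := F)
  have hR' := hR.of_imp_dat (dataSmall7LamTopOf_of_dataRegularRealisedTopOf (F := F) (N := 2))
  have hL3 : (3 : ℝ) ≤ F.L := by exact_mod_cast (show 3 ≤ F.L by have := F.hL11; omega)
  have hB₃0 : 0 ≤ B₃ := le_trans (by positivity) hB₃
  refine ⟨c, c₀, c₁, B₃, a₀, a₁, hB₃, ha₀, ha₁, hR, hR', fun C₁ hC₁ hstep => ?_⟩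
  have hCB : 8 * (F.L : ℝ) ^ 3 < C₁ * B₃ := by
    have hL0 : (0 : ℝ) < (F.L : ℝ) ^ 3 := by positivity
    have hL2 : (9 : ℝ) ≤ (F.L : ℝ) ^ 2 := by nlinarith
    have h1 : 2 * (F.L : ℝ) ^ 3 * (2 * (F.L : ℝ) ^ 2) ≤ C₁ * B₃ := mul_le_mul hC₁ hB₃ (by positivity) (le_trans (by positivity) hC₁)
    have h2 : 8 * (F.L : ℝ) ^ 3 < 2 * (F.L : ℝ) ^ 3 * (2 * (F.L : ℝ) ^ 2) := by nlinarith
    exact h2.trans_le h1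
  exact variationalThm1EUSepCoP7MGB_realised_of_step_of_reg _ (fun ν M g K k s h => gridGuard_le F c c₀ c₁ ν M g K k s h)
    (fun ν M g K k s hk h => gridGuard_truncSeq F c c₀ c₁ ν M g K k s hk h) hB₃0 hC₁ hCB
    (hstep.of_imp_dat (dataSmall7LamTopOf_of_dataRegularRealisedTopOf (F := F) (N := 2))) hR'

end Summit.QuantumFields.YangMills.BalabanUVNodes.N12Thm1EUNameBOfStepAtRealisedDataLam

end
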